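import Summits.Langlands.Langlands.Theses.IrreducibilityBySelfDuality
import Literature.NumberTheory.Automorphic.CuspidalContragredientProofs

/-! Sketch: crux-ideate stmt-Langlands-14322 (ContragredientDatum) — first lemmas of the lines. -/

namespace Summit.Langlands.Langlands.Cruxes.ContragredientDatum.Sketch

open Literature.NumberTheory.Automorphic

/-- Line A (direct discharge): the crux is by `Iff.rfl` the named fact, universally quantified. -/
theorem contragredientDatum_iff :
    Summit.Langlands.Langlands.Theses.IrreducibilityBySelfDuality.ContragredientDatum ↔
      ∀ (n : ℕ) (K : Type) [Field K] [NumberField K] (hcpt : isCompact_glFiniteIntegralLevel n K),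
        CuspidalAutomorphicRepData.exists_contragredient_satake hcpt :=
  Iff.rfl

/-- Line A, first (and last) lemma: the landed discharge closes the crux. -/
theorem contragredientDatum_of_holds :
    Summit.Langlands.Langlands.Theses.IrreducibilityBySelfDuality.ContragredientDatum :=
  fun n K _ _ hcpt => CuspidalAutomorphicRepData.exists_contragredient_satake_holds hcpt

#print axioms contragredientDatum_of_holds

end Summit.Langlands.Langlands.Cruxes.ContragredientDatum.Sketch
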